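import Mathlib
import Summits.ValiantsHypothesis.ValiantsHypothesis.Theorems.NewtonTauWeak.Negative.Zonogon
import Summits.ValiantsHypothesis.ValiantsHypothesis.Theorems.NewtonUnitEquationsNewtonTauWeakSeparatedRank
import Summits.ValiantsHypothesis.ValiantsHypothesis.Theorems.NewtonUnitEquationsNewtonTauWeakHexagonSeparated
import Summits.ValiantsHypothesis.ValiantsHypothesis.Theorems.NewtonUnitEquationsNewtonTauWeakHexagonWronskianStructure

/-!
# `NewtonUnitEquationsNewtonTauWeakThreeRaySparsity` — three rays: the `k`-uniform sparsity-rank remark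

Rung toward `stub_binomialNewtonTauCommon` (T2 = KPTT Conj. 1 at `t = 2`; crux `NewtonTauWeak`,
stmt-ValiantsHypothesis-5904), line `binomial-normal-form`, lead c4 (K-UNIFORM three-ray regime): registered stub
`stub_threeRaySparsity`.

`stub_threeRaySparsity`: for x-only `X_i`, y-only `Y_i` and diagonal `D_i` (`i < k`; supports on the rays
`(1,0)`, `(0,1)`, `(1,1)`, ANY degrees), `vert(Σ_i X_i·Y_i·D_i) ≤ 4 · Σ_i #supp D_i` — uniform in `k`, degree-free,
linear in the total sparsity of the diagonal factors.  Proof: a diagonal monomial splits as x-only times y-only,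
`a·XᶜYᶜ = (a·Xᶜ)·Yᶜ`, so `D_i = Σ_{e ∈ supp D_i} a_e (XY)^{e₀}` is separated of rank `#supp D_i`
(`ThreeRaySparsityAux.sep_diag`); ranks multiply under products (`hex_sep_mul`; `X_i·Y_i` has rank `1`,
`HexagonWronskianStructureAux.sep_one`) and add under finite sums (`ThreeRaySparsityAux.sep_sum` = `hex_sep_add`
iterated; rank bookkeeping via `HexagonWronskianStructureAux.sep_cast`), so `Σ_i X_i Y_i D_i` is separated of
rank `Σ_i #supp D_i`, and the separated-variables rank bound `vert_sum_mul_le_of_separated` (as `hex_vert_le_of_sep`)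
gives `4 ·` rank. [folklore]

Conventions as in `…HexagonSeparated` (spelled inline, no new definitions): "x-only" `P` means
`∀ e ∈ P.support, e 1 = 0`, "y-only" `∀ e ∈ Q.support, e 0 = 0`, "diagonal" `∀ e ∈ D.support, e 0 = e 1`;
"separated of rank `R`" means `m = Σ_{r<R} P_r · Q_r` with `P_r` x-only and `Q_r` y-only.
-/

set_option linter.dupNamespace false

noncomputable section

namespace Summit.ValiantsHypothesis.ValiantsHypothesis.Theorems.NewtonUnitEquationsNewtonTauWeak

open scoped BigOperators
open MvPolynomial
open Summit.ValiantsHypothesis.ValiantsHypothesis.Theorems.NewtonTauWeak.Negative (vert)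

namespace ThreeRaySparsityAux

open HexagonWronskianStructureAux (sep_cast)

/-- Separated ranks add over finite sums (`hex_sep_add` iterated along `Finset.induction_on`). -/
theorem sep_sum {ι : Type*} (s : Finset ι) (R : ι → ℕ) (m : ι → MvPolynomial (Fin 2) ℂ)
    (h : ∀ i ∈ s, ∃ P Q : Fin (R i) → MvPolynomial (Fin 2) ℂ, (∀ r, ∀ e ∈ (P r).support, e 1 = 0) ∧
      (∀ r, ∀ e ∈ (Q r).support, e 0 = 0) ∧ m i = ∑ r, P r * Q r) :
    ∃ P Q : Fin (∑ i ∈ s, R i) → MvPolynomial (Fin 2) ℂ, (∀ r, ∀ e ∈ (P r).support, e 1 = 0) ∧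
      (∀ r, ∀ e ∈ (Q r).support, e 0 = 0) ∧ ∑ i ∈ s, m i = ∑ r, P r * Q r := by
  classical
  induction s using Finset.induction_on with
  | empty =>
    refine ⟨fun _ => 0, fun _ => 0, fun _ e he => ?_, fun _ e he => ?_, ?_⟩
    · rw [support_zero] at he
      exact absurd he (Finset.notMem_empty e)
    · rw [support_zero] at he
      exact absurd he (Finset.notMem_empty e)
    · rw [Finset.sum_empty]
      exact (Finset.sum_eq_zero fun r _ => mul_zero _).symm
  | insert a s ha ih =>
    have h' := hex_sep_add (h a (Finset.mem_insert_self a s))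
      (ih fun i hi => h i (Finset.mem_insert_of_mem hi))
    rw [Finset.sum_insert ha (f := m)]
    exact sep_cast h' (Finset.sum_insert ha).symm

/-- A diagonal monomial splits into x-only times y-only, `a·XᶜYᶜ = (a·Xᶜ)·Yᶜ` (`c = e 0 = e 1`), so it
is separated of rank `1`. -/
theorem sep_monomial_diag (e : Fin 2 →₀ ℕ) (a : ℂ) (he : e 0 = e 1) :
    ∃ P Q : Fin 1 → MvPolynomial (Fin 2) ℂ, (∀ r, ∀ e ∈ (P r).support, e 1 = 0) ∧
      (∀ r, ∀ e ∈ (Q r).support, e 0 = 0) ∧ monomial e a = ∑ r, P r * Q r := by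
  refine ⟨fun _ => monomial (Finsupp.single 0 (e 0)) a, fun _ => monomial (Finsupp.single 1 (e 0)) 1,
    fun _ v hv => ?_, fun _ v hv => ?_, ?_⟩
  · rw [Finset.mem_singleton.mp (support_monomial_subset hv)]
    exact Finsupp.single_eq_of_ne (by decide)
  · rw [Finset.mem_singleton.mp (support_monomial_subset hv)]
    exact Finsupp.single_eq_of_ne (by decide)
  · have hsplit : Finsupp.single 0 (e 0) + Finsupp.single 1 (e 0) = e := by
      ext j
      fin_cases j <;> simp [he]
    rw [Fin.sum_univ_one, monomial_mul, mul_one, hsplit]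

/-- A diagonal polynomial is separated of rank its sparsity: `D = Σ_{e ∈ supp D} a_e·X^{e₀}·Y^{e₀}`
(`MvPolynomial.as_sum` and `sep_monomial_diag`, summed by `sep_sum`). -/
theorem sep_diag (D : MvPolynomial (Fin 2) ℂ) (hD : ∀ e ∈ D.support, e 0 = e 1) :
    ∃ P Q : Fin D.support.card → MvPolynomial (Fin 2) ℂ, (∀ r, ∀ e ∈ (P r).support, e 1 = 0) ∧
      (∀ r, ∀ e ∈ (Q r).support, e 0 = 0) ∧ D = ∑ r, P r * Q r := by
  have h := sep_sum D.support (fun _ => 1) (fun e => monomial e (coeff e D))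
    fun e he => sep_monomial_diag e (coeff e D) (hD e he)
  rw [← as_sum] at h
  exact sep_cast h (by simp)

end ThreeRaySparsityAux

open HexagonWronskianStructureAux (sep_cast sep_one) in
open ThreeRaySparsityAux in
/-- **Three rays: the `k`-uniform sparsity-rank remark.** For x-only `X_i`, y-only `Y_i` and diagonal `D_i`
(`i < k`), `vert(Σ_i X_i·Y_i·D_i) ≤ 4 · Σ_i #supp D_i`: each `D_i` is separated of rank `#supp D_i`
(a diagonal monomial is `(a·Xᶜ)·Yᶜ`), ranks multiply under products (`hex_sep_mul`) and add under sums
(`hex_sep_add`), so `Σ_i X_i·Y_i·D_i` is separated of rank `Σ_i #supp D_i` and the separated-variables rank bound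
`vert_sum_mul_le_of_separated` (`hex_vert_le_of_sep`) applies.  Uniform in `k`, free of the degrees. [folklore] -/
theorem stub_threeRaySparsity (k : ℕ) (X Y D : Fin k → MvPolynomial (Fin 2) ℂ)
    (hX : ∀ i, ∀ e ∈ (X i).support, e 1 = 0) (hY : ∀ i, ∀ e ∈ (Y i).support, e 0 = 0)
    (hD : ∀ i, ∀ e ∈ (D i).support, e 0 = e 1) :
    vert (∑ i, X i * Y i * D i) ≤ 4 * ∑ i, (D i).support.card := by
  have h := sep_sum Finset.univ (fun i => 1 * (D i).support.card) (fun i => X i * Y i * D i)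
    fun i _ => hex_sep_mul (sep_one (X i) (Y i) (hX i) (hY i)) (sep_diag (D i) (hD i))
  exact hex_vert_le_of_sep (sep_cast h (by simp))

end Summit.ValiantsHypothesis.ValiantsHypothesis.Theorems.NewtonUnitEquationsNewtonTauWeak

end
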